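/-
Copyright (c) 2026. All rights reserved.
Released under Apache 2.0 license as described in the file LICENSE.
-/
import Mathlib
import HarnessLib
import Literature.Topology.FourManifolds.HCobordismMiddleLevel
import Literature.Topology.FourManifolds.LevelPassageUntwisted
import Literature.Topology.FourManifolds.LevelPassageDrag
import Literature.Topology.FourManifolds.OddSphereTransport
import Literature.Topology.FourManifolds.HCobordismOddEnd

/-!
# Kirby 1989, Ch. X Thm. 1 (first step): the middle level of an h-cobordism — odd case and discharge

Topic `Literature/Topology/FourManifolds`. The discharge
`exists_middleLevel_isStabilization_of_isHCobordism_holds` of the named fact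
`Literature.Topology.FourManifolds.exists_middleLevel_isStabilization_of_isHCobordism`
(`HCobordismMiddleLevel.lean`; R. C. Kirby, *The topology of 4-manifolds*, LNM 1374 (1989),
Ch. X, proof of Thm. 1, pp. 55–56): an h-cobordism `W` between simply connected closed smooth
4-manifolds `X₁`, `X₂` carries a Morse function with `k` critical points of index `2` below `1/2`
and `k` of index `3` above it whose middle level `N` satisfies
`X₁ # k(S² × S²) ≅ N ≅ X₂ # k(S² × S²)`.

(This file is a sibling of the fact's file rather than an append to it or to
`HCobordismMiddleLevelProofs.lean`: both are imported by `HCobordismMiddleLevelChain.lean`, on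
which the proof depends.)

**§1 The odd case** (Kirby p. 56).  The chain of `LevelPassageUntwisted.lean`
(`Cobordism.isStabilization_level_of_stepAt`, `isStabilization_middleLevel_of_nice_of_stepAt`,
`Cobordism.IsHCobordism.exists_middleLevel_isStabilization_of_stepAt`) re-run with the invariant
"the level contains a map `S² → V` along which `TV ⊕ ℝ` has no framing": it holds for the lowest
level (diffeomorphic to `X₁`, `exists_not_hasStableTangentFramingAlong_of_diffeomorph`), passes up
through each connected sum (`exists_not_hasStableTangentFramingAlong_of_isConnectedSum`,
`OddSphereTransport.lean`), and makes each level passage across an index-2 critical point a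
connected sum with `S² × S²` (`Cobordism.IsHCobordism.isConnectedSum_levels_of_odd`,
`LevelPassageDrag.lean`), giving `Cobordism.IsHCobordism.exists_middleLevel_isStabilization_of_odd` —
the conclusion of the named fact for h-cobordisms both of whose ends are odd.

**§2 The discharge** (Kirby, loc. cit.).  Either `TW♭ ⊕ ℝ` is framed along every map `S² → W♭`
into the interior — Kirby's spin case, *"The framing is zero in `π₁(SO(3)) = ℤ/2` because `W` is
spin"*: every level passage across an index-2 critical point is a connected sum with `S² × S²`
(`Cobordism.IsHCobordism.exists_middleLevel_isStabilization_of_isEven`, `LevelPassageUntwisted.lean`);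
or some such map has no framing — then neither end is even
(`Cobordism.IsHCobordism.exists_not_hasStableTangentFramingAlong_left`, `HCobordismOddEnd.lean`:
the interior deforms onto a low level, Milnor Thm. 3.4 / Cor. 3.5), and §1 applies to `c`
(Kirby p. 56 with Cor. I.4.6: every twisted level passage is untwisted by dragging the attaching
circle around such a sphere).

Everything is proved; no definitions, no named facts.

## References

* R. C. Kirby, *The topology of 4-manifolds*, LNM 1374 (1989), Ch. X, proof of Thm. 1,
  pp. 55–56; Cor. I.4.6. [Kirby1989]
* J. Milnor, *Lectures on the h-cobordism theorem* (1965), Thm. 8.1, Thm. 4.8, Thm. 3.4,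
  Cor. 3.5, §3. [MilnorHCobordism1965]
-/

noncomputable section

open Set Function Metric Matrix Topology Bundle Module
open scoped Topology Manifold ContDiff Real

namespace Literature.Topology.FourManifolds

universe u

open StableFrames GLLoop StdCircleSurgery

/-! ### 1. The chain for one cobordism from an odd end, and the middle level of an odd h-cobordism -/

section Chain

open Cobordism

variable {X₁ X₂ : Type} [TopologicalSpace X₁] [T2Space X₁] [SecondCountableTopology X₁]
  [ChartedSpace (EuclideanSpace ℝ (Fin 4)) X₁] [IsManifold (𝓡 4) ∞ X₁] [CompactSpace X₁] [SimplyConnectedSpace X₁]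
  [TopologicalSpace X₂] [T2Space X₂] [SecondCountableTopology X₂]
  [ChartedSpace (EuclideanSpace ℝ (Fin 4)) X₂] [IsManifold (𝓡 4) ∞ X₂] [CompactSpace X₂]

/-- **The chain of level surgeries below a regular level, for one cobordism** from an odd end: the chain `Cobordism.isStabilization_level_of_stepAt` of `LevelPassageUntwisted.lean` carrying along a sphere map without stable framing in each level (base: the end level is diffeomorphic to `X₁`; step: `exists_not_hasStableTangentFramingAlong_of_isConnectedSum`), with `hstep` asking for such a sphere in the lower level.
[cite: Kirby1989, Ch. X p. 55] [cite: MilnorHCobordism1965, Thm. 3.4, §3 p. 21] -/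
theorem Cobordism.IsHCobordism.isStabilization_level_of_stepOdd {c : Cobordism 4 X₁ X₂} (hc : c.IsHCobordism)
    (hodd₁ : ∃ h : C((sphere (0 : EuclideanSpace ℝ (Fin (2 + 1))) 1), X₁), ¬ HasStableTangentFramingAlong (𝓡 4) X₁ h)
    (hstep : ∀ (g : c.W → ℝ) (q : c.W) (b b₂ : ℝ)
      (V : Type) [TopologicalSpace V] [T2Space V] [ChartedSpace (EuclideanSpace ℝ (Fin 4)) V] [IsManifold (𝓡 4) ∞ V] (ι : V → c.W)
      (V₂ : Type) [TopologicalSpace V₂] [T2Space V₂] [ChartedSpace (EuclideanSpace ℝ (Fin 4)) V₂] [IsManifold (𝓡 4) ∞ V₂] (ι₂ : V₂ → c.W),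
      c.IsMorseFunction g → q ∈ criticalSetOfIndex (𝓡∂ (4 + 1)) g 2 →
      0 < b → b < g q → g q < b₂ → b₂ < 1 →
      (∀ z ∈ criticalSet (𝓡∂ (4 + 1)) g, g z ∈ Icc b b₂ → z = q) →
      (∀ z ∈ criticalSet (𝓡∂ (4 + 1)) g, g z < b → morseIndex (𝓡∂ (4 + 1)) g z = 2) →
      Manifold.IsSmoothEmbedding (𝓡 4) (𝓡∂ (4 + 1)) ∞ ι → range ι = g ⁻¹' {b} →
      Manifold.IsSmoothEmbedding (𝓡 4) (𝓡∂ (4 + 1)) ∞ ι₂ → range ι₂ = g ⁻¹' {b₂} →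
      (∃ h : C((sphere (0 : EuclideanSpace ℝ (Fin (2 + 1))) 1), V), ¬ HasStableTangentFramingAlong (𝓡 4) V h) →
      IsConnectedSum (𝓡 4) (𝓡 4) ((𝓡 2).prod (𝓡 2)) V ((sphere (0 : EuclideanSpace ℝ (Fin (2 + 1))) 1) × (sphere (0 : EuclideanSpace ℝ (Fin (2 + 1))) 1)) V₂)
 {g : c.W → ℝ} (hg : c.IsMorseFunction g)
    {b : ℝ} (hb0 : 0 < b) (hb1 : b < 1) (hreg : ∀ z ∈ criticalSet (𝓡∂ (4 + 1)) g, g z ≠ b)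
    (hidx : ∀ z ∈ criticalSet (𝓡∂ (4 + 1)) g, g z < b → morseIndex (𝓡∂ (4 + 1)) g z = 2)
    (hinj : InjOn g {z | z ∈ criticalSet (𝓡∂ (4 + 1)) g ∧ g z < b})
    (V : Type) [TopologicalSpace V] [T2Space V] [ChartedSpace (EuclideanSpace ℝ (Fin 4)) V] [IsManifold (𝓡 4) ∞ V]
    (ι : V → c.W) (hι : Manifold.IsSmoothEmbedding (𝓡 4) (𝓡∂ (4 + 1)) ∞ ι) (hιr : range ι = g ⁻¹' {b}) :
    IsStabilization {z | z ∈ criticalSet (𝓡∂ (4 + 1)) g ∧ g z < b}.ncard X₁ V ∧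
      ∃ h : C((sphere (0 : EuclideanSpace ℝ (Fin (2 + 1))) 1), V), ¬ HasStableTangentFramingAlong (𝓡 4) V h := by
  classical
  have hfin : (criticalSet (𝓡∂ (4 + 1)) g).Finite := IsMorse.finite_criticalSet_holds hg.isMorse
  -- induction on the number of critical points below the level
  suffices key : ∀ (m : ℕ) (b : ℝ), 0 < b → b < 1 → (∀ z ∈ criticalSet (𝓡∂ (4 + 1)) g, g z ≠ b) →
      (∀ z ∈ criticalSet (𝓡∂ (4 + 1)) g, g z < b → morseIndex (𝓡∂ (4 + 1)) g z = 2) →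
      InjOn g {z | z ∈ criticalSet (𝓡∂ (4 + 1)) g ∧ g z < b} →
      {z | z ∈ criticalSet (𝓡∂ (4 + 1)) g ∧ g z < b}.ncard = m →
      ∀ (V : Type) [TopologicalSpace V] [T2Space V] [ChartedSpace (EuclideanSpace ℝ (Fin 4)) V] [IsManifold (𝓡 4) ∞ V]
        (ι : V → c.W), Manifold.IsSmoothEmbedding (𝓡 4) (𝓡∂ (4 + 1)) ∞ ι → range ι = g ⁻¹' {b} →
        IsStabilization m X₁ V ∧ ∃ h : C((sphere (0 : EuclideanSpace ℝ (Fin (2 + 1))) 1), V), ¬ HasStableTangentFramingAlong (𝓡 4) V h from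
    key _ b hb0 hb1 hreg hidx hinj rfl V ι hι hιr
  intro m
  induction m with
  | zero =>
    intro b hb0 hb1 hreg hidx hinj hcard V _ _ _ _ ι hι hιr
    have hB : {z | z ∈ criticalSet (𝓡∂ (4 + 1)) g ∧ g z < b} = ∅ :=
      (Set.ncard_eq_zero (hfin.subset fun z hz => hz.1)).1 hcard
    have hno : ∀ z ∈ criticalSet (𝓡∂ (4 + 1)) g, b < g z := fun z hz => by
      rcases lt_trichotomy (g z) b with h | h | h
      · exact absurd (show z ∈ {z | z ∈ criticalSet (𝓡∂ (4 + 1)) g ∧ g z < b} from ⟨hz, h⟩)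
          (by rw [hB]; exact notMem_empty z)
      · exact absurd h (hreg z hz)
      · exact h
    obtain ⟨φ⟩ := hg.nonempty_diffeomorph_level_of_forall_le hb0 hb1 hno V ι hι hιr
    exact ⟨(isStabilization_zero_iff X₁ V).2 ⟨φ⟩, exists_not_hasStableTangentFramingAlong_of_diffeomorph φ hodd₁⟩
  | succ m ih =>
    intro b hb0 hb1 hreg hidx hinj hcard V _ _ _ _ ι hι hιr
    set B : Set c.W := {z | z ∈ criticalSet (𝓡∂ (4 + 1)) g ∧ g z < b} with hBdef
    have hBfin : B.Finite := hfin.subset fun z hz => hz.1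
    have hBne : B.Nonempty := by
      by_contra h
      rw [not_nonempty_iff_eq_empty] at h
      rw [h, ncard_empty] at hcard
      exact Nat.succ_ne_zero m hcard.symm
    -- the highest critical point below `b`
    obtain ⟨q, hqB', hqmax⟩ := hBfin.toFinset.exists_max_image g ((Set.Finite.toFinset_nonempty hBfin).2 hBne)
    have hqB : q ∈ B := hBfin.mem_toFinset.1 hqB'
    have hqmax' : ∀ z ∈ B, g z ≤ g q := fun z hz => hqmax z (hBfin.mem_toFinset.2 hz)
    have hqlt : ∀ z ∈ B, z ≠ q → g z < g q := fun z hz hzq =>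
      lt_of_le_of_ne (hqmax' z hz) fun h => hzq (hinj hz hqB h)
    have hqint : (𝓡∂ (4 + 1)).IsInteriorPoint q := by
      by_contra hqb
      exact hg.2.2.2.1 q (((𝓡∂ (4 + 1)).isBoundaryPoint_iff_not_isInteriorPoint q).2 hqb) hqB.1
    have hq0 : 0 < g q := (hg.2.2.2.2 q hqint).1
    -- a regular level `b'` just below `g q`
    obtain ⟨a, ha0, haq, hagap⟩ := exists_gap_below (hfin.toFinset.image g) (half_lt_self hq0)
    set b' : ℝ := (a + g q) / 2 with hb'def
    have hab' : a < b' := by rw [hb'def]; linarith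
    have hb'q : b' < g q := by rw [hb'def]; linarith
    have hb'0 : 0 < b' := by linarith
    have hb'b : b' < b := hb'q.trans hqB.2
    have hb'1 : b' < 1 := hb'b.trans hb1
    have hbelow' : ∀ z ∈ criticalSet (𝓡∂ (4 + 1)) g, g z < g q → g z < a := fun z hz hzq =>
      hagap (g z) (Finset.mem_image_of_mem g (hfin.mem_toFinset.2 hz)) hzq
    -- the critical points below `b'` are those of `B` other than `q`
    have hB' : {z | z ∈ criticalSet (𝓡∂ (4 + 1)) g ∧ g z < b'} = B \ {q} := by
      ext z
      simp only [mem_setOf_eq, Set.mem_sdiff, mem_singleton_iff]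
      constructor
      · rintro ⟨hz, hzb'⟩
        exact ⟨⟨hz, hzb'.trans hb'b⟩, fun h => by rw [h] at hzb'; exact absurd hzb' (not_lt.2 hb'q.le)⟩
      · rintro ⟨hzB, hzq⟩
        exact ⟨hzB.1, (hbelow' z hzB.1 (hqlt z hzB hzq)).trans hab'⟩
    have hreg' : ∀ z ∈ criticalSet (𝓡∂ (4 + 1)) g, g z ≠ b' := by
      intro z hz h
      by_cases hzb : g z < b
      · have hzB : z ∈ B := ⟨hz, hzb⟩
        by_cases hzq : z = q
        · rw [hzq] at h; exact absurd h hb'q.ne'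
        · have := (hbelow' z hz (hqlt z hzB hzq)).trans hab'
          exact absurd h this.ne
      · exact absurd (h ▸ hb'b) hzb
    have hidx' : ∀ z ∈ criticalSet (𝓡∂ (4 + 1)) g, g z < b' → morseIndex (𝓡∂ (4 + 1)) g z = 2 :=
      fun z hz hzb' => hidx z hz (hzb'.trans hb'b)
    have hinj' : InjOn g {z | z ∈ criticalSet (𝓡∂ (4 + 1)) g ∧ g z < b'} := fun z hz w hw h =>
      hinj ⟨hz.1, hz.2.trans hb'b⟩ ⟨hw.1, hw.2.trans hb'b⟩ h
    have hcard' : {z | z ∈ criticalSet (𝓡∂ (4 + 1)) g ∧ g z < b'}.ncard = m := by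
      rw [hB', Set.ncard_sdiff_singleton_of_mem hqB, hcard, Nat.add_sub_cancel]
    -- the level `b'`, presented by the regular level manifold; the induction hypothesis there
    have hlev : IsRegularLevel (𝓡∂ (4 + 1)) g b' := hg.isRegularLevel ⟨hb'0, hb'1⟩ fun z hz => hreg' z hz
    obtain ⟨hih, hoddL⟩ := ih b' hb'0 hb'1 hreg' hidx' hinj' hcard' (RegularLevel hlev) (RegularLevel.incl hlev)
      (RegularLevel.isSmoothEmbedding_incl hlev) (RegularLevel.range_incl hlev)
    -- the passage across `q` is a connected sum
    have honly : ∀ z ∈ criticalSet (𝓡∂ (4 + 1)) g, g z ∈ Icc b' b → z = q := by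
      intro z hz hzI
      have hzb : g z < b := lt_of_le_of_ne hzI.2 (hreg z hz)
      by_contra hzq
      have := (hbelow' z hz (hqlt z ⟨hz, hzb⟩ hzq)).trans hab'
      exact absurd hzI.1 (not_le.2 this)
    have hsum := hstep g q b' b (RegularLevel hlev) (RegularLevel.incl hlev) V ι hg
      ⟨hqB.1, hidx q hqB.1 hqB.2⟩ hb'0 hb'q hqB.2 hb1 honly hidx'
      (RegularLevel.isSmoothEmbedding_incl hlev) (RegularLevel.range_incl hlev) hι hιr hoddL
    -- the odd sphere passes to the upper level through the connected sum
    haveI : SimplyConnectedSpace (RegularLevel hlev) :=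
      hc.simplyConnectedSpace_level_of_index_two hg hb'0 hb'1 hreg' hidx' (RegularLevel hlev) (RegularLevel.incl hlev)
        (RegularLevel.isSmoothEmbedding_incl hlev).isEmbedding (RegularLevel.range_incl hlev)
    have hoddV := exists_not_hasStableTangentFramingAlong_of_isConnectedSum hsum hoddL
    exact ⟨⟨RegularLevel hlev, inferInstance, inferInstance, inferInstance, inferInstance, hih, hsum⟩, hoddV⟩

/-- **The one-sided middle-level statement for nice Morse functions, for one cobordism** (the
tree's `isStabilization_middleLevel_of_nice_of_step` with `hstep` quantified only over `c`;
proof verbatim). [cite: Kirby1989, Ch. X p. 55] [cite: MilnorHCobordism1965, Lemma 2.8 (PDF p. 11), §3 p. 21] -/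
theorem isStabilization_middleLevel_of_nice_of_stepOdd (c : Cobordism 4 X₁ X₂) (hc : c.IsHCobordism)
    (hodd₁ : ∃ h : C((sphere (0 : EuclideanSpace ℝ (Fin (2 + 1))) 1), X₁), ¬ HasStableTangentFramingAlong (𝓡 4) X₁ h)
    (hstep : ∀ (g : c.W → ℝ) (q : c.W) (b b₂ : ℝ)
      (V : Type) [TopologicalSpace V] [T2Space V] [ChartedSpace (EuclideanSpace ℝ (Fin 4)) V] [IsManifold (𝓡 4) ∞ V] (ι : V → c.W)
      (V₂ : Type) [TopologicalSpace V₂] [T2Space V₂] [ChartedSpace (EuclideanSpace ℝ (Fin 4)) V₂] [IsManifold (𝓡 4) ∞ V₂] (ι₂ : V₂ → c.W),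
      c.IsMorseFunction g → q ∈ criticalSetOfIndex (𝓡∂ (4 + 1)) g 2 →
      0 < b → b < g q → g q < b₂ → b₂ < 1 →
      (∀ z ∈ criticalSet (𝓡∂ (4 + 1)) g, g z ∈ Icc b b₂ → z = q) →
      (∀ z ∈ criticalSet (𝓡∂ (4 + 1)) g, g z < b → morseIndex (𝓡∂ (4 + 1)) g z = 2) →
      Manifold.IsSmoothEmbedding (𝓡 4) (𝓡∂ (4 + 1)) ∞ ι → range ι = g ⁻¹' {b} →
      Manifold.IsSmoothEmbedding (𝓡 4) (𝓡∂ (4 + 1)) ∞ ι₂ → range ι₂ = g ⁻¹' {b₂} →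
      (∃ h : C((sphere (0 : EuclideanSpace ℝ (Fin (2 + 1))) 1), V), ¬ HasStableTangentFramingAlong (𝓡 4) V h) →
      IsConnectedSum (𝓡 4) (𝓡 4) ((𝓡 2).prod (𝓡 2)) V ((sphere (0 : EuclideanSpace ℝ (Fin (2 + 1))) 1) × (sphere (0 : EuclideanSpace ℝ (Fin (2 + 1))) 1)) V₂)
    (g : c.W → ℝ)
    (N : Type) [TopologicalSpace N] [T2Space N] [SecondCountableTopology N]
    [ChartedSpace (EuclideanSpace ℝ (Fin 4)) N] [CompactSpace N] [IsManifold (𝓡 4) ∞ N] (e : N → c.W)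
    (hg : c.IsNiceMorseFunction g)
    (h23 : ∀ z, IsMCriticalPt (𝓡∂ (4 + 1)) g z →
      morseIndex (𝓡∂ (4 + 1)) g z = 2 ∨ morseIndex (𝓡∂ (4 + 1)) g z = 3)
    (he : Manifold.IsSmoothEmbedding (𝓡 4) (𝓡∂ (4 + 1)) ∞ e) (her : range e = g ⁻¹' {2⁻¹}) :
    IsStabilization (criticalSetOfIndex (𝓡∂ (4 + 1)) g 2).ncard X₁ N := by
  classical
  have hgM : c.IsMorseFunction g := hg.isMorseFunction
  have hgc : Continuous g := hgM.isMorse.contMDiff.continuous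
  -- the values of the critical points of the nice function
  have hval : ∀ z ∈ criticalSet (𝓡∂ (4 + 1)) g,
      (morseIndex (𝓡∂ (4 + 1)) g z = 2 ∧ g z = 5 / 12) ∨ (morseIndex (𝓡∂ (4 + 1)) g z = 3 ∧ g z = 7 / 12) := by
    intro z hz
    have hv := hg.2 z hz
    rcases h23 z hz with h | h
    · left; rw [hv, h, Cobordism.niceLevel_four_two]; exact ⟨rfl, rfl⟩
    · right; rw [hv, h, Cobordism.niceLevel_four_three]; exact ⟨rfl, rfl⟩
  -- separate the critical values away from the middle level (Lemma 2.8, local form)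
  set O : Set c.W := g ⁻¹' Iio (11 / 24) ∪ g ⁻¹' Ioi (13 / 24) with hOdef
  have hO : IsOpen O := (isOpen_Iio.preimage hgc).union (isOpen_Ioi.preimage hgc)
  have hOc : criticalSet (𝓡∂ (4 + 1)) g ⊆ O := fun z hz => by
    rcases hval z hz with ⟨-, h⟩ | ⟨-, h⟩
    · left; show g z < 11 / 24; rw [h]; norm_num
    · right; show 13 / 24 < g z; rw [h]; norm_num
  obtain ⟨g', hg', hcrit, hidx, hoff, hsmall, hinj⟩ :=
    hgM.exists_injOn_local hO hOc (δ := 1 / 48) (by norm_num)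
  have hmemg : ∀ {z}, z ∈ criticalSet (𝓡∂ (4 + 1)) g' ↔ z ∈ criticalSet (𝓡∂ (4 + 1)) g := fun {z} => by
    rw [hcrit]
  -- values of `g'` at the critical points
  have hval' : ∀ z ∈ criticalSet (𝓡∂ (4 + 1)) g',
      (morseIndex (𝓡∂ (4 + 1)) g' z = 2 ∧ g' z < 2⁻¹) ∨ (morseIndex (𝓡∂ (4 + 1)) g' z = 3 ∧ 2⁻¹ < g' z) := by
    intro z hz'
    have hz : z ∈ criticalSet (𝓡∂ (4 + 1)) g := hmemg.1 hz'
    have hs := abs_lt.1 (hsmall z)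
    rcases hval z hz with ⟨hi, hv⟩ | ⟨hi, hv⟩
    · left; refine ⟨by rw [hidx z hz, hi], ?_⟩; rw [hv] at hs; norm_num at hs ⊢; linarith [hs.2]
    · right; refine ⟨by rw [hidx z hz, hi], ?_⟩; rw [hv] at hs; norm_num at hs ⊢; linarith [hs.1]
  -- the middle level is unchanged
  have hlevel : g' ⁻¹' {2⁻¹} = g ⁻¹' {2⁻¹} := by
    ext z
    simp only [mem_preimage, mem_singleton_iff]
    by_cases hzO : z ∈ O
    · have hs := abs_lt.1 (hsmall z)
      rcases hzO with h | h
      · have h' : g z < 11 / 24 := h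
        constructor
        · intro h1; exfalso; norm_num at hs h1; linarith [hs.2]
        · intro h1; exfalso; norm_num at h1; linarith
      · have h' : 13 / 24 < g z := h
        constructor
        · intro h1; exfalso; norm_num at hs h1; linarith [hs.1]
        · intro h1; exfalso; norm_num at h1; linarith
    · rw [hoff z hzO]
  -- the chain at `b = 1/2`
  have hreg : ∀ z ∈ criticalSet (𝓡∂ (4 + 1)) g', g' z ≠ 2⁻¹ := fun z hz h => by
    rcases hval' z hz with ⟨-, hlt⟩ | ⟨-, hgt⟩
    · exact hlt.ne h
    · exact hgt.ne' h
  have hidx2 : ∀ z ∈ criticalSet (𝓡∂ (4 + 1)) g', g' z < 2⁻¹ → morseIndex (𝓡∂ (4 + 1)) g' z = 2 := fun z hz hzb => by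
    rcases hval' z hz with ⟨h2, -⟩ | ⟨-, hgt⟩
    · exact h2
    · exact absurd hzb (not_lt.2 hgt.le)
  have hinj' : InjOn g' {z | z ∈ criticalSet (𝓡∂ (4 + 1)) g' ∧ g' z < 2⁻¹} := fun z hz w hw h =>
    hinj (hmemg.1 hz.1) (hmemg.1 hw.1) h
  have hchain := (hc.isStabilization_level_of_stepOdd hodd₁ hstep hg' (b := 2⁻¹) (by norm_num) (by norm_num) hreg hidx2
    hinj' N e he (by rw [her, hlevel])).1
  -- the count: the critical points of `g'` below `1/2` are the index-2 critical points of `g`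
  have hset : {z | z ∈ criticalSet (𝓡∂ (4 + 1)) g' ∧ g' z < 2⁻¹} = criticalSetOfIndex (𝓡∂ (4 + 1)) g 2 := by
    ext z
    simp only [mem_setOf_eq, mem_criticalSetOfIndex]
    constructor
    · rintro ⟨hz', hzb⟩
      have hz : z ∈ criticalSet (𝓡∂ (4 + 1)) g := hmemg.1 hz'
      exact ⟨hz, by rw [← hidx z hz]; exact hidx2 z hz' hzb⟩
    · rintro ⟨hz, h2⟩
      have hz' : z ∈ criticalSet (𝓡∂ (4 + 1)) g' := hmemg.2 hz
      refine ⟨hz', ?_⟩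
      rcases hval' z hz' with ⟨-, hlt⟩ | ⟨h3, -⟩
      · exact hlt
      · rw [hidx z hz, h2] at h3; exact absurd h3 (by norm_num)
  rw [hset] at hchain
  exact hchain

/-- **The middle level of an h-cobordism for which the level passages of `c` and of the
cobordism turned about are connected sums** (the tree's
`exists_middleLevel_isStabilization_of_isHCobordism_of_oneSided_nice`, read for ONE cobordism:
Thm. 8.1 both ways, the final rearrangement 4.8 to a nice Morse function, presentation of the
middle level, the one-sided statement `isStabilization_middleLevel_of_nice_of_stepAt` for `c` and
for `c.symm` (whose total space is that of `c`), and the index flip). [cite: Kirby1989, Ch. X, proof of Thm. 1, p. 55] [cite: MilnorHCobordism1965, Thm. 4.8, §3 p. 21, proof of Thm. 9.1 (PDF p. 57)] -/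
theorem Cobordism.IsHCobordism.exists_middleLevel_isStabilization_of_stepOdd (c : Cobordism 4 X₁ X₂) (hc : c.IsHCobordism)
    (hodd₁ : ∃ h : C((sphere (0 : EuclideanSpace ℝ (Fin (2 + 1))) 1), X₁), ¬ HasStableTangentFramingAlong (𝓡 4) X₁ h)
    (hodd₂ : ∃ h : C((sphere (0 : EuclideanSpace ℝ (Fin (2 + 1))) 1), X₂), ¬ HasStableTangentFramingAlong (𝓡 4) X₂ h)
    (hstep : ∀ (g : c.W → ℝ) (q : c.W) (b b₂ : ℝ)
      (V : Type) [TopologicalSpace V] [T2Space V] [ChartedSpace (EuclideanSpace ℝ (Fin 4)) V] [IsManifold (𝓡 4) ∞ V] (ι : V → c.W)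
      (V₂ : Type) [TopologicalSpace V₂] [T2Space V₂] [ChartedSpace (EuclideanSpace ℝ (Fin 4)) V₂] [IsManifold (𝓡 4) ∞ V₂] (ι₂ : V₂ → c.W),
      c.IsMorseFunction g → q ∈ criticalSetOfIndex (𝓡∂ (4 + 1)) g 2 →
      0 < b → b < g q → g q < b₂ → b₂ < 1 →
      (∀ z ∈ criticalSet (𝓡∂ (4 + 1)) g, g z ∈ Icc b b₂ → z = q) →
      (∀ z ∈ criticalSet (𝓡∂ (4 + 1)) g, g z < b → morseIndex (𝓡∂ (4 + 1)) g z = 2) →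
      Manifold.IsSmoothEmbedding (𝓡 4) (𝓡∂ (4 + 1)) ∞ ι → range ι = g ⁻¹' {b} →
      Manifold.IsSmoothEmbedding (𝓡 4) (𝓡∂ (4 + 1)) ∞ ι₂ → range ι₂ = g ⁻¹' {b₂} →
      (∃ h : C((sphere (0 : EuclideanSpace ℝ (Fin (2 + 1))) 1), V), ¬ HasStableTangentFramingAlong (𝓡 4) V h) →
      IsConnectedSum (𝓡 4) (𝓡 4) ((𝓡 2).prod (𝓡 2)) V ((sphere (0 : EuclideanSpace ℝ (Fin (2 + 1))) 1) × (sphere (0 : EuclideanSpace ℝ (Fin (2 + 1))) 1)) V₂)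
    (hstep' : ∀ (g : c.symm.W → ℝ) (q : c.symm.W) (b b₂ : ℝ)
      (V : Type) [TopologicalSpace V] [T2Space V] [ChartedSpace (EuclideanSpace ℝ (Fin 4)) V] [IsManifold (𝓡 4) ∞ V] (ι : V → c.symm.W)
      (V₂ : Type) [TopologicalSpace V₂] [T2Space V₂] [ChartedSpace (EuclideanSpace ℝ (Fin 4)) V₂] [IsManifold (𝓡 4) ∞ V₂] (ι₂ : V₂ → c.symm.W),
      c.symm.IsMorseFunction g → q ∈ criticalSetOfIndex (𝓡∂ (4 + 1)) g 2 →
      0 < b → b < g q → g q < b₂ → b₂ < 1 →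
      (∀ z ∈ criticalSet (𝓡∂ (4 + 1)) g, g z ∈ Icc b b₂ → z = q) →
      (∀ z ∈ criticalSet (𝓡∂ (4 + 1)) g, g z < b → morseIndex (𝓡∂ (4 + 1)) g z = 2) →
      Manifold.IsSmoothEmbedding (𝓡 4) (𝓡∂ (4 + 1)) ∞ ι → range ι = g ⁻¹' {b} →
      Manifold.IsSmoothEmbedding (𝓡 4) (𝓡∂ (4 + 1)) ∞ ι₂ → range ι₂ = g ⁻¹' {b₂} →
      (∃ h : C((sphere (0 : EuclideanSpace ℝ (Fin (2 + 1))) 1), V), ¬ HasStableTangentFramingAlong (𝓡 4) V h) →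
      IsConnectedSum (𝓡 4) (𝓡 4) ((𝓡 2).prod (𝓡 2)) V ((sphere (0 : EuclideanSpace ℝ (Fin (2 + 1))) 1) × (sphere (0 : EuclideanSpace ℝ (Fin (2 + 1))) 1)) V₂)
    : ∃ (f : c.W → ℝ) (k : ℕ) (N : Type) (_ : TopologicalSpace N) (_ : T2Space N)
        (_ : SecondCountableTopology N) (_ : ChartedSpace (EuclideanSpace ℝ (Fin 4)) N) (_ : CompactSpace N)
        (_ : IsManifold (𝓡 4) ∞ N) (e : N → c.W),
        c.IsMorseFunction f ∧
        (∀ z, IsMCriticalPt (𝓡∂ (4 + 1)) f z →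
          morseIndex (𝓡∂ (4 + 1)) f z = 2 ∧ f z < 2⁻¹ ∨
            morseIndex (𝓡∂ (4 + 1)) f z = 3 ∧ 2⁻¹ < f z) ∧
        (criticalSetOfIndex (𝓡∂ (4 + 1)) f 2).ncard = k ∧
        (criticalSetOfIndex (𝓡∂ (4 + 1)) f 3).ncard = k ∧
        Manifold.IsSmoothEmbedding (𝓡 4) (𝓡∂ (4 + 1)) ∞ e ∧ range e = f ⁻¹' {2⁻¹} ∧
        FourManifolds.IsStabilization k X₁ N ∧ FourManifolds.IsStabilization k X₂ N := by
  obtain ⟨f, hf, hind, hcount⟩ := exists_isMorseFunction_two_three_of_isHCobordism_holds X₁ X₂ c hc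
  -- Thm. 4.8: a nice Morse function with the same critical points and indices
  obtain ⟨g, hg, hcs, hidx⟩ := Cobordism.Milnor1965_finalRearrangement_holds hf
  have hcrit : ∀ z, IsMCriticalPt (𝓡∂ (4 + 1)) g z ↔ IsMCriticalPt (𝓡∂ (4 + 1)) f z := fun z => by
    rw [← mem_criticalSet, hcs, mem_criticalSet]
  have hset : ∀ j, criticalSetOfIndex (𝓡∂ (4 + 1)) g j = criticalSetOfIndex (𝓡∂ (4 + 1)) f j := by
    intro j
    ext z
    simp only [mem_criticalSetOfIndex]
    constructor
    · rintro ⟨hz, hj⟩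
      have hzf : IsMCriticalPt (𝓡∂ (4 + 1)) f z := (hcrit z).mp hz
      exact ⟨hzf, by rw [← hidx z (mem_criticalSet.mpr hzf)]; exact hj⟩
    · rintro ⟨hz, hj⟩
      exact ⟨(hcrit z).mpr hz, by rw [hidx z (mem_criticalSet.mpr hz)]; exact hj⟩
  have hind23 : ∀ z, IsMCriticalPt (𝓡∂ (4 + 1)) g z →
      morseIndex (𝓡∂ (4 + 1)) g z = 2 ∨ morseIndex (𝓡∂ (4 + 1)) g z = 3 := by
    intro z hz
    have hzf : IsMCriticalPt (𝓡∂ (4 + 1)) f z := (hcrit z).mp hz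
    rw [hidx z (mem_criticalSet.mpr hzf)]
    rcases hind z hzf with ⟨h2, -⟩ | ⟨h3, -⟩
    · exact Or.inl h2
    · exact Or.inr h3
  have hindg : ∀ z, IsMCriticalPt (𝓡∂ (4 + 1)) g z →
      morseIndex (𝓡∂ (4 + 1)) g z = 2 ∧ g z < 2⁻¹ ∨ morseIndex (𝓡∂ (4 + 1)) g z = 3 ∧ 2⁻¹ < g z := by
    intro z hz
    have hval := hg.apply_eq hz
    rcases hind23 z hz with h2 | h3
    · left
      refine ⟨h2, ?_⟩
      rw [hval, h2]
      exact Cobordism.niceLevel_four_two_lt_half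
    · right
      refine ⟨h3, ?_⟩
      rw [hval, h3]
      exact Cobordism.half_lt_niceLevel_four_three
  have hreg : ∀ z, IsMCriticalPt (𝓡∂ (4 + 1)) g z → g z ≠ 2⁻¹ := fun z hz hz' =>
    not_isMCriticalPt_of_apply_eq hindg hz' hz
  obtain ⟨N, _, _, _, _, _, _, e, he, hrange⟩ :=
    hg.isMorseFunction.exists_isSmoothEmbedding_range_eq ⟨by norm_num, by norm_num⟩ hreg
  -- the `X₁` side
  have hX₁ : IsStabilization (criticalSetOfIndex (𝓡∂ (4 + 1)) g 2).ncard X₁ N :=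
    isStabilization_middleLevel_of_nice_of_stepOdd c hc hodd₁ hstep g N e hg hind23 he hrange
  -- the `X₂` side: turn the cobordism about; `1 - g` is again nice
  haveI : SimplyConnectedSpace X₂ := hc.simplyConnectedSpace_iff_right.mp hc.simplyConnectedSpace
  have hrange' : range e = (fun w => 1 - g w) ⁻¹' {2⁻¹} := by
    rw [preimage_one_sub_half]; exact hrange
  have hind23' : ∀ z, IsMCriticalPt (𝓡∂ (4 + 1)) (fun w => 1 - g w) z →
      morseIndex (𝓡∂ (4 + 1)) (fun w => 1 - g w) z = 2 ∨
        morseIndex (𝓡∂ (4 + 1)) (fun w => 1 - g w) z = 3 := by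
    intro z hz
    rcases hg.isMorseFunction.two_three_one_sub hindg z hz with ⟨h2, -⟩ | ⟨h3, -⟩
    · exact Or.inl h2
    · exact Or.inr h3
  have hX₂ := isStabilization_middleLevel_of_nice_of_stepOdd c.symm hc.symm hodd₂ hstep' (fun w => 1 - g w) N e hg.symm
    hind23' he hrange'
  have hX₂' : IsStabilization (criticalSetOfIndex (𝓡∂ (4 + 1)) g 3).ncard X₂ N := by
    rw [← hg.isMorseFunction.criticalSetOfIndex_one_sub_two]
    exact hX₂
  refine ⟨g, (criticalSetOfIndex (𝓡∂ (4 + 1)) g 2).ncard, N, ‹_›, ‹_›, ‹_›, ‹_›, ‹_›, ‹_›, e,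
    hg.isMorseFunction, hindg, rfl, ?_, he, hrange, hX₁, ?_⟩
  · rw [hset 2, hset 3]; exact hcount.symm
  · rw [hset 2, hcount, ← hset 3]
    exact hX₂'

/-- **Kirby 1989, Ch. X, proof of Thm. 1, p. 56 — the middle level of an h-cobordism between
odd simply connected closed 4-manifolds** (the odd case of the named fact
`Literature.Topology.FourManifolds.exists_middleLevel_isStabilization_of_isHCobordism`, with "odd"
in the elementary form "some map `S² → Xᵢ` has no framing of `TXᵢ ⊕ ℝ` along it"): every level
of `c` and of the cobordism turned about contains such a sphere map (it passes up through the
connected sums, `exists_not_hasStableTangentFramingAlong_of_isConnectedSum`), so every level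
passage across an index-2 critical point is a connected sum with `S² × S²` after a drag
(`Cobordism.IsHCobordism.isConnectedSum_levels_of_odd`), and the chain assembles the middle
level. [cite: Kirby1989, Ch. X, proof of Thm. 1, pp. 55–56, Cor. I.4.6] [cite: MilnorHCobordism1965, Thm. 8.1 (PDF pp. 50–57), Thm. 4.8, §3 p. 21] -/
theorem Cobordism.IsHCobordism.exists_middleLevel_isStabilization_of_odd (c : Cobordism 4 X₁ X₂) (hc : c.IsHCobordism)
    (hodd₁ : ∃ h : C((sphere (0 : EuclideanSpace ℝ (Fin (2 + 1))) 1), X₁), ¬ HasStableTangentFramingAlong (𝓡 4) X₁ h)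
    (hodd₂ : ∃ h : C((sphere (0 : EuclideanSpace ℝ (Fin (2 + 1))) 1), X₂), ¬ HasStableTangentFramingAlong (𝓡 4) X₂ h) :
    ∃ (f : c.W → ℝ) (k : ℕ) (N : Type) (_ : TopologicalSpace N) (_ : T2Space N)
        (_ : SecondCountableTopology N) (_ : ChartedSpace (EuclideanSpace ℝ (Fin 4)) N) (_ : CompactSpace N)
        (_ : IsManifold (𝓡 4) ∞ N) (e : N → c.W),
        c.IsMorseFunction f ∧
        (∀ z, IsMCriticalPt (𝓡∂ (4 + 1)) f z →
          morseIndex (𝓡∂ (4 + 1)) f z = 2 ∧ f z < 2⁻¹ ∨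
            morseIndex (𝓡∂ (4 + 1)) f z = 3 ∧ 2⁻¹ < f z) ∧
        (criticalSetOfIndex (𝓡∂ (4 + 1)) f 2).ncard = k ∧
        (criticalSetOfIndex (𝓡∂ (4 + 1)) f 3).ncard = k ∧
        Manifold.IsSmoothEmbedding (𝓡 4) (𝓡∂ (4 + 1)) ∞ e ∧ range e = f ⁻¹' {2⁻¹} ∧
        FourManifolds.IsStabilization k X₁ N ∧ FourManifolds.IsStabilization k X₂ N := by
  haveI : SimplyConnectedSpace X₂ := hc.simplyConnectedSpace_iff_right.mp hc.simplyConnectedSpace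
  exact hc.exists_middleLevel_isStabilization_of_stepOdd c hodd₁ hodd₂
    (fun g q b b₂ V _ _ _ _ ι V₂ _ _ _ _ ι₂ hg hq hb hbq hqb₂ hb₂ honly hidx hι hιr hι₂ hι₂r hoddV =>
      hc.isConnectedSum_levels_of_odd hg hq hb hbq hqb₂ hb₂ honly hidx V ι hι hιr hoddV V₂ ι₂ hι₂ hι₂r)
    (fun g q b b₂ V _ _ _ _ ι V₂ _ _ _ _ ι₂ hg hq hb hbq hqb₂ hb₂ honly hidx hι hιr hι₂ hι₂r hoddV =>
      hc.symm.isConnectedSum_levels_of_odd hg hq hb hbq hqb₂ hb₂ honly hidx V ι hι hιr hoddV V₂ ι₂ hι₂ hι₂r)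

end Chain

/-! ### 2. The discharge -/

section Discharge

/-- **Kirby 1989, Ch. X, proof of Thm. 1, pp. 55–56 — discharge of
`exists_middleLevel_isStabilization_of_isHCobordism`.**  For an h-cobordism `W⁵` between
simply connected closed smooth 4-manifolds `X₁`, `X₂` there are a Morse function with `k` critical
points of index `2` below `1/2` and `k` of index `3` above it and a presentation `N` of the middle
level with `X₁ # k(S² × S²) ≅ N ≅ X₂ # k(S² × S²)`: the even case
(`Cobordism.IsHCobordism.exists_middleLevel_isStabilization_of_isEven`) or, when some map
`S² → W♭` has no stable tangent framing, both ends are odd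
(`Cobordism.IsHCobordism.exists_not_hasStableTangentFramingAlong_left` for `c` and for the
cobordism turned about) and the odd case applies
(`Cobordism.IsHCobordism.exists_middleLevel_isStabilization_of_odd`).
[cite: Kirby1989, Ch. X, proof of Thm. 1, pp. 55–56, Cor. I.4.6] [cite: MilnorHCobordism1965, Thm. 8.1 (PDF pp. 50–57), Thm. 4.8, Thm. 3.4, Cor. 3.5] -/
theorem exists_middleLevel_isStabilization_of_isHCobordism_holds :
    exists_middleLevel_isStabilization_of_isHCobordism := by
  intro X₁ X₂ _ _ _ _ _ _ _ _ _ _ _ _ _ c hc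
  by_cases heven : ∀ T : C((sphere (0 : EuclideanSpace ℝ (Fin (2 + 1))) 1), Cobordism.PassageSetting.Wb c),
      HasStableTangentFramingAlong (𝓡 (4 + 1)) (Cobordism.PassageSetting.Wb c) T
  · exact Cobordism.IsHCobordism.exists_middleLevel_isStabilization_of_isEven c hc heven
  · push Not at heven
    haveI : SimplyConnectedSpace X₂ := hc.simplyConnectedSpace_iff_right.mp hc.simplyConnectedSpace
    have hodd₁ := Cobordism.IsHCobordism.exists_not_hasStableTangentFramingAlong_left c hc heven
    have hodd₂ := Cobordism.IsHCobordism.exists_not_hasStableTangentFramingAlong_left c.symm hc.symm heven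
    exact Cobordism.IsHCobordism.exists_middleLevel_isStabilization_of_odd c hc hodd₁ hodd₂

end Discharge

end Literature.Topology.FourManifolds
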